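import Summits.QuantumFields.YangMills.Theorems.BalabanUVNodesN11NoExpansionGeneralStepRePinned
import Literature.MathematicalPhysics.QuantumFieldTheory.Balaban1983to89.B16RLeafRecord13LiveGenericZS

/-!
# DAG node N11 — THE NO-EXPANSION STEP AFTER AN ARBITRARY HISTORY AT THE RE-PINNED v1.7 PARAMETER `rePinH θ`, READ THROUGH 𝐑: the post-𝐑 §2 dichotomy of
# `ρ_{k+1}`'s slot at every new sequence `s′` with `Ω_{k+1}(s′) = ∅` — ANY `Ω_1, …, Ω_k` — on the live-selector line, with the residual-slot binders (P) `hpre`,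
# (V) `hZ`, `hq`, `hqloc` of the generic files GONE (dag-n11-d's `…NoExpansionGeneralStepRePinned` ∘ this seat's Φ-generic clause-level 𝐑-transfer `…LiveGenericZS` §0)

Cell `pub-ymgap`, YM-PLAN Track A (HUMAN RULING D-0062), seat `pub-ymgap-dag-n11-e` (g13; R134 fan-out row N11∕s3 «`ThmP245Printed` via `rOperation` from N13's
`ROpLeaf` (pairs with n13-c)»), route `BalabanUVNodes` rev 25 (v1.7 `CoPH` key), item K1⁷ `StabilityBAtRecordR13SepCoPH` = stmt-QuantumFields-20542 (helper lane,
count-neutral).  [III] = [Balaban1988Convergent], [IV] = [Balaban1989LargeFieldI].  The re-pinned companion of this seat's `…NoExpansionGeneralStepPostRCoPH` (p549093)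
and `…NoExpansionGeneralStepPostRCoPHOldBranch` (p549854).

WHY THIS FILE.  The generic post-𝐑 faces (p549093 ∕ p549854) carry dag-n11-d's four residual-slot binders on the history's 𝐓-weight residual `θ.zhAt p s′` — (P) the
prefix agreement `hpre`, (V) the generation-`k` pin with the old front factor `hZ`, and `hq` ∕ `hqloc` — which no VALUE in the tree met off the all-large-field diagonal.
dag-n11-d's `rePinH θ` (p552185: `θ` with its history-indexed residual slot replaced by the level-free certificate family `ZhPinOfRecord₁₃`, every other field unchanged;
every proviso ∕ guard of the K⁷ texts transfers, `provisos₁₃CoPH_rePinH`, `antecedent_rePinH`) makes all four THEOREMS at EVERY no-expansion history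
(`prefix_agree_rePinH`, `zhAt_rePinH_ζ0_univ_pairCfgAt`, `quad ≡ 0`), and p553094 records the 𝐓-side step there.  Since `rePinH θ` and `θ` have the SAME Stage-13 part,
the renormalized densities `ρ_k`, their slots, def-R's background and node00-def-T's selector clause are literally those of `θ`: re-pinning changes only the 𝐓-weight
certificate in the §2 form, not the measures.  HENCE, reading p553094 through 𝐑 (row `rstep` of `θ.Provisos₁₃CoPH`, the live-selector clause of `θ`; this seat's
`slotClauseΦ_succ_of_slotTClauseΦ_of_liveSel_of_rstep`, right-hand side `Φ` arbitrary so the re-pinned weights are met by `rfl`):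
§1 (generic `θ : Stage13HParams`) `slotClause_succ_rePinH_of_Omega_empty_of_provisos_of_clause_of_liveSel` (clause-keyed: the level-`k` clause `hid` at `init s′` in the
   re-pinned weights ⇒ the post-𝐑 §2 dichotomy of `ρ_{k+1}`'s slot at `s′`; displayed ONLY `hA` and `hm` ∕ `hC`) · `…_of_oldBranch_of_clause_of_liveSel` (`hmB` ∕ `hCB` form) ·
   ★★ `exists_slotClause_succ_rePinH_of_Omega_empty_of_sLaw₁₃CoPH_of_liveSel` and ★★ `…_of_sLaw₁₃CoPH_of_oldBranch_of_liveSel` — keyed on `SLaw₁₃CoPH (rePinH θ) p k` ITSELF: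
   THEOREM 1's INDUCTIVE STEP ON EVERY NO-EXPANSION BRANCH AFTER ANY HISTORY, post-𝐑, at the re-pinned parameter, from the §2 form of `ρ_k` there, the core provisos, the
   selector clause, `k < K`, `1 ≤ M`, and the analytic rows `hA` + (`hm` ∕ `hC` or `hmB` ∕ `hCB`) ONLY.
§2 ★★ `exists_slotClause_succ_rePinH_door_ofCured_of_Omega_empty_of_liveSel` — AT THE RE-PINNED DOOR OF node00-def-K0a's CURED WITNESS FAMILY
   `rePinH (Stage13HParams.ofHistoryBlind (Stage13RParams.ofCured θ₀))`, from `θ₀.Provisos₁₃Core`, the selector clause of `θ₀`, `SLaw` there, `hA`, `hmB` ∕ `hCB` (p553094 §4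
   read through 𝐑; p549854 §2 reached the diagonal only) · ★★ `exists_slotClause_succ_rePinH_door_theta13LiveOfRecord_of_Omega_empty` — at `θ₀ := theta13LiveOfRecord F N` the
   selector clause and row `rstep` are K0a ∕ K0b ∕ def-R THEOREMS (`slotClauseΦ_succ_of_slotTClauseΦ_theta13LiveOfRecord`) and `M = 1` by the family's numerals.

HONEST FRAMING.  Count-neutral kernel bookkeeping — two seats' tree theorems composed by name, ONE application each, at a NAMED tree term (`rePinH θ`); the certificate
family is NOT H3's value of record (dag-n11-d's A1 header says where it is K0a's cured residual verbatim); the sequences with `Ω_{k+1}(s′) ≠ ∅` are [III] Sect. 1 ∕ §3 ∕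
Thm 2 proper — untouched; the analytic rows `hA` (`hB`), `hm` ∕ `hC` (`hmB` ∕ `hCB`) stay DISPLAYED exactly as in p544575 ∕ p547524 (dag-n11-d's located dead ends: term values
carry no global measurability law; the restricted-averaging kernel no sup bound); the dichotomy's zero branch is not excluded; nothing of Bałaban asserted; N11 NOT
discharged; K1⁷ NOT closed; counts unmoved (typed 28∕28 · discharged 5∕27).  One finite `𝕋⁴_{L^K}` programme at fixed `ε = L^{−K}`; NOT ℝ⁴, NOT OS, NOT a mass gap, NOT Clay.
Sources: [III] Thm 1 p.262, Theorem p.245, (2.17)–(2.18) p.257, (2.20)–(2.25) pp.258–259, (3.16)–(3.20) pp.268–269, (3.24)–(3.25) p.270, (1.11) p.248; [IV] (0.2)–(0.4) p.176,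
p.177 (i)–(ii).
-/

noncomputable section

open MeasureTheory
open scoped BigOperators Matrix.Norms.L2Operator

namespace Summit.QuantumFields.YangMills.Theorems.BalabanUVNodesN11NoExpansionGeneralStepRePinnedPostRCoPH

open Literature.MathematicalPhysics.QuantumFieldTheory.Balaban1983to89 T4Continuum Node00 Node00.Tk DagBinding
open Literature.MathematicalPhysics.QuantumFieldTheory.Balaban1983to89.B16RLeafRecord13LiveGenericZS
open BalabanUVNodesN11RePinnedParamDefs (rePinH)
open BalabanUVNodesN11NoExpansionGeneralStepRePinned (clause_succ_rePinH_of_Omega_empty_of_provisos_of_clause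
  exists_clause_succ_rePinH_of_Omega_empty_of_sLaw₁₃CoPH clause_succ_rePinH_of_Omega_empty_of_oldBranch_of_clause
  exists_clause_succ_rePinH_of_Omega_empty_of_sLaw₁₃CoPH_of_oldBranch exists_clause_succ_rePinH_door_ofCured_of_Omega_empty)

variable {F : T4Family} {N : ℕ} [NeZero N]

/-! ## §1. Generic `θ : Stage13HParams`, at the re-pinned parameter `rePinH θ`, on the live-selector line -/

section RePinned

variable (θ : Stage13HParams F N) (p : B12.RunParams)

/-- **THE NO-EXPANSION STEP AFTER AN ARBITRARY HISTORY AT `rePinH θ`, READ THROUGH 𝐑 — clause-keyed.**  From node00-def-T's v1.7 core provisos AT `θ` (row `rstep` is the 𝐑-side;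
they transfer to `rePinH θ` for the 𝐓-side), the live-selector clause of `θ`, `k < K`, `1 ≤ M`, a new sequence `s′` of length `k+1` with `Ω_{k+1}(s′) = ∅` (ANY `Ω_1, …, Ω_k`),
a witness `(t, E₀)` with the old action's fluctuation-locality `hA` and the level-`k` clause `hid` at `init s′` IN THE RE-PINNED WEIGHTS, and the measurability ∕ bound
`hm` ∕ `hC` of the no-expansion integrand: the post-𝐑 slot of `ρ_{k+1}` at `s′` is absent, or equals `𝐓_{k+1}(s′)[WtOfRecord₁₃H (rePinH θ) p s′] e^{A_{k+1}(s′)}` at `(t, E₀)`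
a.e. on `supp χ_{k+1}(s′)` — NO (P) ∕ (V) ∕ `hq` ∕ `hqloc` hypothesis (dag-n11-d's `clause_succ_rePinH_of_Omega_empty_of_provisos_of_clause`, then this seat's
`slotClauseΦ_succ_of_slotTClauseΦ_of_liveSel_of_rstep`). [cite: Balaban1988Convergent, Thm 1 p.262, Theorem p.245, (3.24)–(3.25) p.270, (2.18) p.257, (2.20)–(2.25) pp.258–259, (3.16)–(3.20) pp.268–269; Balaban1989LargeFieldI, (0.2)–(0.4) p.176, p.177 (i)–(ii)] -/
theorem slotClause_succ_rePinH_of_Omega_empty_of_provisos_of_clause_of_liveSel (h : θ.Provisos₁₃CoPH F N)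
    (hsel : θ.ppSel = ppSelLiveOfRecord F N θ.ν θ.τ9 (EOfRecord₁₃ F N θ.toStage13Params) (wOfRecord₉ F N θ.toStage9Params))
    {k : ℕ} (hk : k < p.K) (hM : 1 ≤ θ.τ9.M)
    (s : SeqOfRecord F θ.ν θ.τ9.M (gOfRecord₁₃ F N θ.toStage13Params p) p.K (k + 1)) (hΩ : s.Ω (k + 1) = ∅)
    (t : Sect2.TermValues (F.P p.K) (MatA N) (FluctV N) θ.τ9.M) (E₀ : ℝ)
    (hA : ∀ (S : ℕ → Set (Site (F.P p.K) 0)) (a a' : Tk.MSFluct (F.P p.K) (FluctV N)) (Uf : GaugeField (F.P p.K) 0 (SU N)), (∀ i, i ≤ k → a i = a' i) →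
      (sect2ActionDataOfRecord F N (FluctV N) p.K (settingOfRecord₁₃ F N θ.toStage13Params p) (θ.rzAt p s.init) s.init t (S, a) E₀).action23 k Uf =
        (sect2ActionDataOfRecord F N (FluctV N) p.K (settingOfRecord₁₃ F N θ.toStage13Params p) (θ.rzAt p s.init) s.init t (S, a') E₀).action23 k Uf)
    (hid : slotsOfRecord F N θ.ν θ.τ9 (EOfRecord₁₃ F N θ.toStage13Params) (wOfRecord₉ F N θ.toStage9Params) θ.ppSel p
        (gOfRecord₁₃ F N θ.toStage13Params p) k s.init = 0 ∨
      ∀ᵐ U₀ ∂fieldMeasure (F.P p.K) k (SU N),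
        chiSeqOfRecord F N θ.ν θ.τ9.M (gOfRecord₁₃ F N θ.toStage13Params p) p.K k s.init U₀ ≠ 0 →
          slotsOfRecord F N θ.ν θ.τ9 (EOfRecord₁₃ F N θ.toStage13Params) (wOfRecord₉ F N θ.toStage9Params) θ.ppSel p
              (gOfRecord₁₃ F N θ.toStage13Params p) k s.init U₀ =
            sect2Slot F N (FluctV N) p.K (settingOfRecord₁₃ F N θ.toStage13Params p) (θ.rzAt p s.init) (WtOfRecord₁₃H F N (rePinH θ) p s.init) s.init t E₀
              (UbgOfRecord₁₃CoP F N θ.toStage13Params p k s.init) U₀)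
    {C : ℝ}
    (hm : ∀ S ∈ admSOfRecord F θ.ν θ.τ9.M (gOfRecord₁₃ F N θ.toStage13Params p) p.K k s.init,
      Measurable (Function.uncurry (noExpIntegrandAt F N (FluctV N) p.K k (WtOfRecord₁₃H F N (rePinH θ) p s)
        (tkBranchOfRecord F N (FluctV N) θ.ν θ.τ9.M _ p.K (WtOfRecord₁₃H F N (rePinH θ) p s) s.init S k
          (fun ω => sect2Operand F N (FluctV N) p.K (settingOfRecord₁₃ F N θ.toStage13Params p) (θ.rzAt p s) s t E₀
            (UbgOfRecord₁₃CoP F N θ.toStage13Params p (k + 1) s) (S, fun j => (ω j).2) (fun j => (ω j).1))))))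
    (hC : ∀ S ∈ admSOfRecord F θ.ν θ.τ9.M (gOfRecord₁₃ F N θ.toStage13Params p) p.K k s.init, ∀ V' U₀,
      |noExpIntegrandAt F N (FluctV N) p.K k (WtOfRecord₁₃H F N (rePinH θ) p s)
        (tkBranchOfRecord F N (FluctV N) θ.ν θ.τ9.M _ p.K (WtOfRecord₁₃H F N (rePinH θ) p s) s.init S k
          (fun ω => sect2Operand F N (FluctV N) p.K (settingOfRecord₁₃ F N θ.toStage13Params p) (θ.rzAt p s) s t E₀
            (UbgOfRecord₁₃CoP F N θ.toStage13Params p (k + 1) s) (S, fun j => (ω j).2) (fun j => (ω j).1)))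
        V' U₀| ≤ C) :
    slotsOfRecord F N θ.ν θ.τ9 (EOfRecord₁₃ F N θ.toStage13Params) (wOfRecord₉ F N θ.toStage9Params) θ.ppSel p
        (gOfRecord₁₃ F N θ.toStage13Params p) (k + 1) s = 0 ∨
      ∀ᵐ V' ∂fieldMeasure (F.P p.K) (k + 1) (SU N),
        chiSeqOfRecord F N θ.ν θ.τ9.M (gOfRecord₁₃ F N θ.toStage13Params p) p.K (k + 1) s V' ≠ 0 →
          slotsOfRecord F N θ.ν θ.τ9 (EOfRecord₁₃ F N θ.toStage13Params) (wOfRecord₉ F N θ.toStage9Params) θ.ppSel p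
              (gOfRecord₁₃ F N θ.toStage13Params p) (k + 1) s V' =
            sect2Slot F N (FluctV N) p.K (settingOfRecord₁₃ F N θ.toStage13Params p) (θ.rzAt p s) (WtOfRecord₁₃H F N (rePinH θ) p s) s t E₀
              (UbgOfRecord₁₃CoP F N θ.toStage13Params p (k + 1) s) V' :=
  -- 𝐓-side: dag-n11-d's clause-keyed step at `rePinH θ` ((P), (V), `hq`, `hqloc` discharged there); 𝐑-side: this seat's Φ-generic transfer at one sequence
  slotClauseΦ_succ_of_slotTClauseΦ_of_liveSel_of_rstep F N θ.toStage13Params p (fun q j _ hj => h.rstep q j hj) hsel k hk s _ fun _ =>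
    clause_succ_rePinH_of_Omega_empty_of_provisos_of_clause θ p h hk hM s hΩ t E₀ hA hid hm hC

/-- **… OLD-BRANCH FORM** (`hm` ∕ `hC` replaced by measurability ∕ bound of the OLD branch `U ↦ 𝐓_k(init s′, S)[e^{A_k(init s′)}](U)`, `hmB` ∕ `hCB` — dag-n11-d's
`clause_succ_rePinH_of_Omega_empty_of_oldBranch_of_clause`), read through 𝐑 on the live-selector line; NO (P) ∕ (V) ∕ `hq` ∕ `hqloc` hypothesis.
[cite: Balaban1988Convergent, Thm 1 p.262, Theorem p.245, (3.24)–(3.25) p.270, (2.18) p.257, (2.20)–(2.25) pp.258–259, (3.16) p.268; Balaban1989LargeFieldI, (0.2)–(0.4) p.176, p.177 (i)–(ii)] -/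
theorem slotClause_succ_rePinH_of_Omega_empty_of_oldBranch_of_clause_of_liveSel (h : θ.Provisos₁₃CoPH F N)
    (hsel : θ.ppSel = ppSelLiveOfRecord F N θ.ν θ.τ9 (EOfRecord₁₃ F N θ.toStage13Params) (wOfRecord₉ F N θ.toStage9Params))
    {k : ℕ} (hk : k < p.K) (hM : 1 ≤ θ.τ9.M)
    (s : SeqOfRecord F θ.ν θ.τ9.M (gOfRecord₁₃ F N θ.toStage13Params p) p.K (k + 1)) (hΩ : s.Ω (k + 1) = ∅)
    (t : Sect2.TermValues (F.P p.K) (MatA N) (FluctV N) θ.τ9.M) (E₀ : ℝ)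
    (hA : ∀ (S : ℕ → Set (Site (F.P p.K) 0)) (a a' : Tk.MSFluct (F.P p.K) (FluctV N)) (Uf : GaugeField (F.P p.K) 0 (SU N)), (∀ i, i ≤ k → a i = a' i) →
      (sect2ActionDataOfRecord F N (FluctV N) p.K (settingOfRecord₁₃ F N θ.toStage13Params p) (θ.rzAt p s.init) s.init t (S, a) E₀).action23 k Uf =
        (sect2ActionDataOfRecord F N (FluctV N) p.K (settingOfRecord₁₃ F N θ.toStage13Params p) (θ.rzAt p s.init) s.init t (S, a') E₀).action23 k Uf)
    (hid : slotsOfRecord F N θ.ν θ.τ9 (EOfRecord₁₃ F N θ.toStage13Params) (wOfRecord₉ F N θ.toStage9Params) θ.ppSel p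
        (gOfRecord₁₃ F N θ.toStage13Params p) k s.init = 0 ∨
      ∀ᵐ U₀ ∂fieldMeasure (F.P p.K) k (SU N),
        chiSeqOfRecord F N θ.ν θ.τ9.M (gOfRecord₁₃ F N θ.toStage13Params p) p.K k s.init U₀ ≠ 0 →
          slotsOfRecord F N θ.ν θ.τ9 (EOfRecord₁₃ F N θ.toStage13Params) (wOfRecord₉ F N θ.toStage9Params) θ.ppSel p
              (gOfRecord₁₃ F N θ.toStage13Params p) k s.init U₀ =
            sect2Slot F N (FluctV N) p.K (settingOfRecord₁₃ F N θ.toStage13Params p) (θ.rzAt p s.init) (WtOfRecord₁₃H F N (rePinH θ) p s.init) s.init t E₀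
              (UbgOfRecord₁₃CoP F N θ.toStage13Params p k s.init) U₀)
    {C : ℝ}
    (hmB : ∀ S ∈ admSOfRecord F θ.ν θ.τ9.M (gOfRecord₁₃ F N θ.toStage13Params p) p.K k s.init,
      Measurable fun U₀ : GaugeField (F.P p.K) k (SU N) =>
        tkBranchOfRecord F N (FluctV N) θ.ν θ.τ9.M _ p.K (WtOfRecord₁₃H F N (rePinH θ) p s) s.init S k
          (fun ω => sect2Operand F N (FluctV N) p.K (settingOfRecord₁₃ F N θ.toStage13Params p) (θ.rzAt p s.init) s.init t E₀
            (UbgOfRecord₁₃CoP F N θ.toStage13Params p k s.init) (S, fun j => (ω j).2) (fun j => (ω j).1))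
          (baseCfg (V := FluctV N) k U₀))
    (hCB : ∀ S ∈ admSOfRecord F θ.ν θ.τ9.M (gOfRecord₁₃ F N θ.toStage13Params p) p.K k s.init, ∀ U₀ : GaugeField (F.P p.K) k (SU N),
      |tkBranchOfRecord F N (FluctV N) θ.ν θ.τ9.M _ p.K (WtOfRecord₁₃H F N (rePinH θ) p s) s.init S k
          (fun ω => sect2Operand F N (FluctV N) p.K (settingOfRecord₁₃ F N θ.toStage13Params p) (θ.rzAt p s.init) s.init t E₀
            (UbgOfRecord₁₃CoP F N θ.toStage13Params p k s.init) (S, fun j => (ω j).2) (fun j => (ω j).1))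
          (baseCfg (V := FluctV N) k U₀)| ≤ C) :
    slotsOfRecord F N θ.ν θ.τ9 (EOfRecord₁₃ F N θ.toStage13Params) (wOfRecord₉ F N θ.toStage9Params) θ.ppSel p
        (gOfRecord₁₃ F N θ.toStage13Params p) (k + 1) s = 0 ∨
      ∀ᵐ V' ∂fieldMeasure (F.P p.K) (k + 1) (SU N),
        chiSeqOfRecord F N θ.ν θ.τ9.M (gOfRecord₁₃ F N θ.toStage13Params p) p.K (k + 1) s V' ≠ 0 →
          slotsOfRecord F N θ.ν θ.τ9 (EOfRecord₁₃ F N θ.toStage13Params) (wOfRecord₉ F N θ.toStage9Params) θ.ppSel p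
              (gOfRecord₁₃ F N θ.toStage13Params p) (k + 1) s V' =
            sect2Slot F N (FluctV N) p.K (settingOfRecord₁₃ F N θ.toStage13Params p) (θ.rzAt p s) (WtOfRecord₁₃H F N (rePinH θ) p s) s t E₀
              (UbgOfRecord₁₃CoP F N θ.toStage13Params p (k + 1) s) V' :=
  slotClauseΦ_succ_of_slotTClauseΦ_of_liveSel_of_rstep F N θ.toStage13Params p (fun q j _ hj => h.rstep q j hj) hsel k hk s _ fun _ =>
    clause_succ_rePinH_of_Omega_empty_of_oldBranch_of_clause θ p h hk hM s hΩ t E₀ hA hid hmB hCB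

/-- **★★ THEOREM 1's INDUCTIVE STEP ON THE NO-EXPANSION BRANCH AFTER ANY HISTORY, READ THROUGH 𝐑, AT THE RE-PINNED PARAMETER — keyed on `SLaw₁₃CoPH (rePinH θ) p k` ITSELF.**
From the §2 form of `ρ_k` in the re-pinned weights, the core provisos at `θ`, the live-selector clause, `k < K`, `1 ≤ M`, and — at a new sequence `s′` with `Ω_{k+1}(s′) = ∅`
after ANY history — ONLY the analytic rows `hA`, `hm`, `hC` (for every `(t₀, E₀)`): THERE ARE term values and a constant with the §2 dichotomy of `ρ_{k+1}`'s post-𝐑 slot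
at `s′` in the re-pinned weights (witness `t (init s′)`, `E_{k+1}(s′) = E_k(init s′)`; dag-n11-d's `exists_clause_succ_rePinH_of_Omega_empty_of_sLaw₁₃CoPH`, then this
seat's 𝐑-transfer).  The four residual-slot binders of p549093's generic face are theorems at `rePinH θ`. [cite: Balaban1988Convergent, Thm 1 p.262, Theorem p.245, (3.24)–(3.25) p.270, (2.17)–(2.18) p.257, (2.20)–(2.25) pp.258–259, (3.16)–(3.20) pp.268–269, (1.11) p.248; Balaban1989LargeFieldI, (0.2)–(0.4) p.176, p.177 (i)–(ii)] -/
theorem exists_slotClause_succ_rePinH_of_Omega_empty_of_sLaw₁₃CoPH_of_liveSel (h : θ.Provisos₁₃CoPH F N)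
    (hsel : θ.ppSel = ppSelLiveOfRecord F N θ.ν θ.τ9 (EOfRecord₁₃ F N θ.toStage13Params) (wOfRecord₉ F N θ.toStage9Params))
    {k : ℕ} (hk : k < p.K) (hM : 1 ≤ θ.τ9.M) (hS : SLaw₁₃CoPH F N (rePinH θ) p k)
    (s : SeqOfRecord F θ.ν θ.τ9.M (gOfRecord₁₃ F N θ.toStage13Params p) p.K (k + 1)) (hΩ : s.Ω (k + 1) = ∅)
    (hA : ∀ (t₀ : Sect2.TermValues (F.P p.K) (MatA N) (FluctV N) θ.τ9.M) (E₀ : ℝ) (S : ℕ → Set (Site (F.P p.K) 0))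
      (a a' : Tk.MSFluct (F.P p.K) (FluctV N)) (Uf : GaugeField (F.P p.K) 0 (SU N)), (∀ i, i ≤ k → a i = a' i) →
      (sect2ActionDataOfRecord F N (FluctV N) p.K (settingOfRecord₁₃ F N θ.toStage13Params p) (θ.rzAt p s.init) s.init t₀ (S, a) E₀).action23 k Uf =
        (sect2ActionDataOfRecord F N (FluctV N) p.K (settingOfRecord₁₃ F N θ.toStage13Params p) (θ.rzAt p s.init) s.init t₀ (S, a') E₀).action23 k Uf)
    {C : ℝ}
    (hm : ∀ (t₀ : Sect2.TermValues (F.P p.K) (MatA N) (FluctV N) θ.τ9.M) (E₀ : ℝ),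
      ∀ S ∈ admSOfRecord F θ.ν θ.τ9.M (gOfRecord₁₃ F N θ.toStage13Params p) p.K k s.init,
      Measurable (Function.uncurry (noExpIntegrandAt F N (FluctV N) p.K k (WtOfRecord₁₃H F N (rePinH θ) p s)
        (tkBranchOfRecord F N (FluctV N) θ.ν θ.τ9.M _ p.K (WtOfRecord₁₃H F N (rePinH θ) p s) s.init S k
          (fun ω => sect2Operand F N (FluctV N) p.K (settingOfRecord₁₃ F N θ.toStage13Params p) (θ.rzAt p s) s t₀ E₀
            (UbgOfRecord₁₃CoP F N θ.toStage13Params p (k + 1) s) (S, fun j => (ω j).2) (fun j => (ω j).1))))))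
    (hC : ∀ (t₀ : Sect2.TermValues (F.P p.K) (MatA N) (FluctV N) θ.τ9.M) (E₀ : ℝ),
      ∀ S ∈ admSOfRecord F θ.ν θ.τ9.M (gOfRecord₁₃ F N θ.toStage13Params p) p.K k s.init, ∀ V' U₀,
      |noExpIntegrandAt F N (FluctV N) p.K k (WtOfRecord₁₃H F N (rePinH θ) p s)
        (tkBranchOfRecord F N (FluctV N) θ.ν θ.τ9.M _ p.K (WtOfRecord₁₃H F N (rePinH θ) p s) s.init S k
          (fun ω => sect2Operand F N (FluctV N) p.K (settingOfRecord₁₃ F N θ.toStage13Params p) (θ.rzAt p s) s t₀ E₀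
            (UbgOfRecord₁₃CoP F N θ.toStage13Params p (k + 1) s) (S, fun j => (ω j).2) (fun j => (ω j).1)))
        V' U₀| ≤ C) :
    ∃ (t₀ : Sect2.TermValues (F.P p.K) (MatA N) (FluctV N) θ.τ9.M) (E' : ℝ),
      slotsOfRecord F N θ.ν θ.τ9 (EOfRecord₁₃ F N θ.toStage13Params) (wOfRecord₉ F N θ.toStage9Params) θ.ppSel p
          (gOfRecord₁₃ F N θ.toStage13Params p) (k + 1) s = 0 ∨
        ∀ᵐ V' ∂fieldMeasure (F.P p.K) (k + 1) (SU N),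
          chiSeqOfRecord F N θ.ν θ.τ9.M (gOfRecord₁₃ F N θ.toStage13Params p) p.K (k + 1) s V' ≠ 0 →
            slotsOfRecord F N θ.ν θ.τ9 (EOfRecord₁₃ F N θ.toStage13Params) (wOfRecord₉ F N θ.toStage9Params) θ.ppSel p
                (gOfRecord₁₃ F N θ.toStage13Params p) (k + 1) s V' =
              sect2Slot F N (FluctV N) p.K (settingOfRecord₁₃ F N θ.toStage13Params p) (θ.rzAt p s) (WtOfRecord₁₃H F N (rePinH θ) p s) s t₀ E'
                (UbgOfRecord₁₃CoP F N θ.toStage13Params p (k + 1) s) V' := by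
  obtain ⟨t₀, E', hT⟩ := exists_clause_succ_rePinH_of_Omega_empty_of_sLaw₁₃CoPH θ p h hk hM hS s hΩ hA hm hC
  exact ⟨t₀, E', slotClauseΦ_succ_of_slotTClauseΦ_of_liveSel_of_rstep F N θ.toStage13Params p (fun q j _ hj => h.rstep q j hj) hsel k hk s _ fun _ => hT⟩

/-- **★★ … OLD-BRANCH FORM, keyed on `SLaw₁₃CoPH (rePinH θ) p k` ITSELF**: the same with `hm` ∕ `hC` replaced by the OLD-BRANCH measurability ∕ bound `hmB` ∕ `hCB` for every
`(t₀, E₀)` — nothing about the new integrand, no residual-slot binder (dag-n11-d's `exists_clause_succ_rePinH_of_Omega_empty_of_sLaw₁₃CoPH_of_oldBranch`, then this seat's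
𝐑-transfer).  At `rePinH θ`, `hmB` further reduces to measurability of the operand alone (dag-n11-d's `…RePinnedOldBranchMeasurable`, in flight).
[cite: Balaban1988Convergent, Thm 1 p.262, Theorem p.245, (3.24)–(3.25) p.270, (2.17)–(2.18) p.257, (2.20)–(2.25) pp.258–259, (3.16) p.268, (1.11) p.248; Balaban1989LargeFieldI, (0.2)–(0.4) p.176, p.177 (i)–(ii)] -/
theorem exists_slotClause_succ_rePinH_of_Omega_empty_of_sLaw₁₃CoPH_of_oldBranch_of_liveSel (h : θ.Provisos₁₃CoPH F N)
    (hsel : θ.ppSel = ppSelLiveOfRecord F N θ.ν θ.τ9 (EOfRecord₁₃ F N θ.toStage13Params) (wOfRecord₉ F N θ.toStage9Params))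
    {k : ℕ} (hk : k < p.K) (hM : 1 ≤ θ.τ9.M) (hS : SLaw₁₃CoPH F N (rePinH θ) p k)
    (s : SeqOfRecord F θ.ν θ.τ9.M (gOfRecord₁₃ F N θ.toStage13Params p) p.K (k + 1)) (hΩ : s.Ω (k + 1) = ∅)
    (hA : ∀ (t₀ : Sect2.TermValues (F.P p.K) (MatA N) (FluctV N) θ.τ9.M) (E₀ : ℝ) (S : ℕ → Set (Site (F.P p.K) 0))
      (a a' : Tk.MSFluct (F.P p.K) (FluctV N)) (Uf : GaugeField (F.P p.K) 0 (SU N)), (∀ i, i ≤ k → a i = a' i) →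
      (sect2ActionDataOfRecord F N (FluctV N) p.K (settingOfRecord₁₃ F N θ.toStage13Params p) (θ.rzAt p s.init) s.init t₀ (S, a) E₀).action23 k Uf =
        (sect2ActionDataOfRecord F N (FluctV N) p.K (settingOfRecord₁₃ F N θ.toStage13Params p) (θ.rzAt p s.init) s.init t₀ (S, a') E₀).action23 k Uf)
    {C : ℝ}
    (hmB : ∀ (t₀ : Sect2.TermValues (F.P p.K) (MatA N) (FluctV N) θ.τ9.M) (E₀ : ℝ),
      ∀ S ∈ admSOfRecord F θ.ν θ.τ9.M (gOfRecord₁₃ F N θ.toStage13Params p) p.K k s.init,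
      Measurable fun U₀ : GaugeField (F.P p.K) k (SU N) =>
        tkBranchOfRecord F N (FluctV N) θ.ν θ.τ9.M _ p.K (WtOfRecord₁₃H F N (rePinH θ) p s) s.init S k
          (fun ω => sect2Operand F N (FluctV N) p.K (settingOfRecord₁₃ F N θ.toStage13Params p) (θ.rzAt p s.init) s.init t₀ E₀
            (UbgOfRecord₁₃CoP F N θ.toStage13Params p k s.init) (S, fun j => (ω j).2) (fun j => (ω j).1))
          (baseCfg (V := FluctV N) k U₀))
    (hCB : ∀ (t₀ : Sect2.TermValues (F.P p.K) (MatA N) (FluctV N) θ.τ9.M) (E₀ : ℝ),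
      ∀ S ∈ admSOfRecord F θ.ν θ.τ9.M (gOfRecord₁₃ F N θ.toStage13Params p) p.K k s.init, ∀ U₀ : GaugeField (F.P p.K) k (SU N),
      |tkBranchOfRecord F N (FluctV N) θ.ν θ.τ9.M _ p.K (WtOfRecord₁₃H F N (rePinH θ) p s) s.init S k
          (fun ω => sect2Operand F N (FluctV N) p.K (settingOfRecord₁₃ F N θ.toStage13Params p) (θ.rzAt p s.init) s.init t₀ E₀
            (UbgOfRecord₁₃CoP F N θ.toStage13Params p k s.init) (S, fun j => (ω j).2) (fun j => (ω j).1))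
          (baseCfg (V := FluctV N) k U₀)| ≤ C) :
    ∃ (t₀ : Sect2.TermValues (F.P p.K) (MatA N) (FluctV N) θ.τ9.M) (E' : ℝ),
      slotsOfRecord F N θ.ν θ.τ9 (EOfRecord₁₃ F N θ.toStage13Params) (wOfRecord₉ F N θ.toStage9Params) θ.ppSel p
          (gOfRecord₁₃ F N θ.toStage13Params p) (k + 1) s = 0 ∨
        ∀ᵐ V' ∂fieldMeasure (F.P p.K) (k + 1) (SU N),
          chiSeqOfRecord F N θ.ν θ.τ9.M (gOfRecord₁₃ F N θ.toStage13Params p) p.K (k + 1) s V' ≠ 0 →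
            slotsOfRecord F N θ.ν θ.τ9 (EOfRecord₁₃ F N θ.toStage13Params) (wOfRecord₉ F N θ.toStage9Params) θ.ppSel p
                (gOfRecord₁₃ F N θ.toStage13Params p) (k + 1) s V' =
              sect2Slot F N (FluctV N) p.K (settingOfRecord₁₃ F N θ.toStage13Params p) (θ.rzAt p s) (WtOfRecord₁₃H F N (rePinH θ) p s) s t₀ E'
                (UbgOfRecord₁₃CoP F N θ.toStage13Params p (k + 1) s) V' := by
  obtain ⟨t₀, E', hT⟩ := exists_clause_succ_rePinH_of_Omega_empty_of_sLaw₁₃CoPH_of_oldBranch θ p h hk hM hS s hΩ hA hmB hCB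
  exact ⟨t₀, E', slotClauseΦ_succ_of_slotTClauseΦ_of_liveSel_of_rstep F N θ.toStage13Params p (fun q j _ hj => h.rstep q j hj) hsel k hk s _ fun _ => hT⟩

end RePinned

/-! ## §2. At the re-pinned door of node00-def-K0a's cured witness family — `θ₀.Provisos₁₃Core`, EVERY no-expansion history (not only the diagonal) -/

section Door

variable (θ₀ : Stage13Params F N) (p : B12.RunParams)

/-- **★★ THE GENERAL-HISTORY NO-EXPANSION STEP, READ THROUGH 𝐑, AT THE RE-PINNED DOOR `rePinH (Stage13HParams.ofHistoryBlind (Stage13RParams.ofCured θ₀))` OF K0a's CURED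
WITNESS FAMILY, AT EVERY NO-EXPANSION HISTORY** (this seat's p549854 §2 reached the all-large DIAGONAL only, the door being history-blind): from `θ₀.Provisos₁₃Core`,
node00-def-T's live-selector clause of `θ₀`, `SLaw₁₃CoPH` at the re-pinned door at level `k`, `k < K`, `1 ≤ M`, the old action's fluctuation-locality `hA` and the old-branch
`hmB` ∕ `hCB` ONLY — for EVERY `s′` of length `k+1` with `Ω_{k+1}(s′) = ∅`, whatever `Ω_1(s′), …, Ω_k(s′)`: THERE ARE term values and a constant with the §2 dichotomy of
`ρ_{k+1}`'s post-𝐑 slot at `s′` in the re-pinned door's weights (dag-n11-d's `exists_clause_succ_rePinH_door_ofCured_of_Omega_empty`; the 𝐑-side is row `rstep` of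
`Provisos₁₃Core` and the selector clause — `θ₀` IS the re-pinned door's Stage-13 part). [cite: Balaban1988Convergent, Thm 1 p.262, Theorem p.245, (3.24)–(3.25) p.270, (2.18) p.257, (2.20)–(2.25) pp.258–259, (3.16)–(3.20) pp.268–269, (1.11) p.248; Balaban1989LargeFieldI, (0.3)–(0.4) p.176, p.177 (i)–(ii)] -/
theorem exists_slotClause_succ_rePinH_door_ofCured_of_Omega_empty_of_liveSel (h : θ₀.Provisos₁₃Core F N)
    (hsel : θ₀.ppSel = ppSelLiveOfRecord F N θ₀.ν θ₀.τ9 (EOfRecord₁₃ F N θ₀) (wOfRecord₉ F N θ₀.toStage9Params))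
    {k : ℕ} (hk : k < p.K) (hM : 1 ≤ θ₀.τ9.M)
    (hS : SLaw₁₃CoPH F N (rePinH (Stage13HParams.ofHistoryBlind F N (Stage13RParams.ofCured F N θ₀))) p k)
    (s : SeqOfRecord F θ₀.ν θ₀.τ9.M (gOfRecord₁₃ F N θ₀ p) p.K (k + 1)) (hΩ : s.Ω (k + 1) = ∅)
    (hA : ∀ (t₀ : Sect2.TermValues (F.P p.K) (MatA N) (FluctV N) θ₀.τ9.M) (E₀ : ℝ) (S : ℕ → Set (Site (F.P p.K) 0))
      (a a' : Tk.MSFluct (F.P p.K) (FluctV N)) (Uf : GaugeField (F.P p.K) 0 (SU N)), (∀ i, i ≤ k → a i = a' i) →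
      (sect2ActionDataOfRecord F N (FluctV N) p.K (settingOfRecord₁₃ F N θ₀ p) (θ₀.Rz p.K) s.init t₀ (S, a) E₀).action23 k Uf =
        (sect2ActionDataOfRecord F N (FluctV N) p.K (settingOfRecord₁₃ F N θ₀ p) (θ₀.Rz p.K) s.init t₀ (S, a') E₀).action23 k Uf)
    {C : ℝ}
    (hmB : ∀ (t₀ : Sect2.TermValues (F.P p.K) (MatA N) (FluctV N) θ₀.τ9.M) (E₀ : ℝ),
      ∀ S ∈ admSOfRecord F θ₀.ν θ₀.τ9.M (gOfRecord₁₃ F N θ₀ p) p.K k s.init,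
      Measurable fun U₀ : GaugeField (F.P p.K) k (SU N) =>
        tkBranchOfRecord F N (FluctV N) θ₀.ν θ₀.τ9.M _ p.K
          (WtOfRecord₁₃H F N (rePinH (Stage13HParams.ofHistoryBlind F N (Stage13RParams.ofCured F N θ₀))) p s) s.init S k
          (fun ω => sect2Operand F N (FluctV N) p.K (settingOfRecord₁₃ F N θ₀ p) (θ₀.Rz p.K) s.init t₀ E₀
            (UbgOfRecord₁₃CoP F N θ₀ p k s.init) (S, fun j => (ω j).2) (fun j => (ω j).1))
          (baseCfg (V := FluctV N) k U₀))
    (hCB : ∀ (t₀ : Sect2.TermValues (F.P p.K) (MatA N) (FluctV N) θ₀.τ9.M) (E₀ : ℝ),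
      ∀ S ∈ admSOfRecord F θ₀.ν θ₀.τ9.M (gOfRecord₁₃ F N θ₀ p) p.K k s.init, ∀ U₀ : GaugeField (F.P p.K) k (SU N),
      |tkBranchOfRecord F N (FluctV N) θ₀.ν θ₀.τ9.M _ p.K
          (WtOfRecord₁₃H F N (rePinH (Stage13HParams.ofHistoryBlind F N (Stage13RParams.ofCured F N θ₀))) p s) s.init S k
          (fun ω => sect2Operand F N (FluctV N) p.K (settingOfRecord₁₃ F N θ₀ p) (θ₀.Rz p.K) s.init t₀ E₀
            (UbgOfRecord₁₃CoP F N θ₀ p k s.init) (S, fun j => (ω j).2) (fun j => (ω j).1))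
          (baseCfg (V := FluctV N) k U₀)| ≤ C) :
    ∃ (t₀ : Sect2.TermValues (F.P p.K) (MatA N) (FluctV N) θ₀.τ9.M) (E' : ℝ),
      slotsOfRecord F N θ₀.ν θ₀.τ9 (EOfRecord₁₃ F N θ₀) (wOfRecord₉ F N θ₀.toStage9Params) θ₀.ppSel p (gOfRecord₁₃ F N θ₀ p) (k + 1) s = 0 ∨
        ∀ᵐ V' ∂fieldMeasure (F.P p.K) (k + 1) (SU N),
          chiSeqOfRecord F N θ₀.ν θ₀.τ9.M (gOfRecord₁₃ F N θ₀ p) p.K (k + 1) s V' ≠ 0 →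
            slotsOfRecord F N θ₀.ν θ₀.τ9 (EOfRecord₁₃ F N θ₀) (wOfRecord₉ F N θ₀.toStage9Params) θ₀.ppSel p (gOfRecord₁₃ F N θ₀ p) (k + 1) s V' =
              sect2Slot F N (FluctV N) p.K (settingOfRecord₁₃ F N θ₀ p) (θ₀.Rz p.K)
                (WtOfRecord₁₃H F N (rePinH (Stage13HParams.ofHistoryBlind F N (Stage13RParams.ofCured F N θ₀))) p s) s t₀ E'
                (UbgOfRecord₁₃CoP F N θ₀ p (k + 1) s) V' := by
  obtain ⟨t₀, E', hT⟩ := exists_clause_succ_rePinH_door_ofCured_of_Omega_empty θ₀ p h hk hM hS s hΩ hA hmB hCB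
  exact ⟨t₀, E', slotClauseΦ_succ_of_slotTClauseΦ_of_liveSel_of_rstep F N θ₀ p (fun q j _ hj => h.rstep q j hj) hsel k hk s _ fun _ => hT⟩

end Door

section DoorRecord

variable (F N)
variable (p : B12.RunParams)

/-- **★★ … AT THE RE-PINNED DOOR OF THE CURED WITNESS OF RECORD** `rePinH (Stage13HParams.ofHistoryBlind (Stage13RParams.ofCured (theta13LiveOfRecord F N)))`, AT EVERY
NO-EXPANSION HISTORY: from `Provisos₁₃Core` AT THE WITNESS, `k < K`, `SLaw₁₃CoPH` at the re-pinned door at level `k`, `hA` and the old-branch `hmB` ∕ `hCB` ONLY — the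
selector clause and row `rstep` are K0a ∕ K0b ∕ def-R THEOREMS there (`slotClauseΦ_succ_of_slotTClauseΦ_theta13LiveOfRecord`, zero hypotheses beyond `k < K`), `M = 1` by the
family's numerals. [cite: Balaban1988Convergent, Thm 1 p.262, Theorem p.245, (3.24)–(3.25) p.270, (1.11) p.248, (3.16)–(3.22) pp.268–269; Balaban1989LargeFieldI, (0.3)–(0.4) p.176, p.177 (i)–(ii)] -/
theorem exists_slotClause_succ_rePinH_door_theta13LiveOfRecord_of_Omega_empty (h : (theta13LiveOfRecord F N).Provisos₁₃Core F N) {k : ℕ} (hk : k < p.K)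
    (hS : SLaw₁₃CoPH F N (rePinH (Stage13HParams.ofHistoryBlind F N (Stage13RParams.ofCured F N (theta13LiveOfRecord F N)))) p k)
    (s : SeqOfRecord F (theta13LiveOfRecord F N).ν (theta13LiveOfRecord F N).τ9.M (gOfRecord₁₃ F N (theta13LiveOfRecord F N) p) p.K (k + 1))
    (hΩ : s.Ω (k + 1) = ∅)
    (hA : ∀ (t₀ : Sect2.TermValues (F.P p.K) (MatA N) (FluctV N) (theta13LiveOfRecord F N).τ9.M) (E₀ : ℝ) (S : ℕ → Set (Site (F.P p.K) 0))
      (a a' : Tk.MSFluct (F.P p.K) (FluctV N)) (Uf : GaugeField (F.P p.K) 0 (SU N)), (∀ i, i ≤ k → a i = a' i) →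
      (sect2ActionDataOfRecord F N (FluctV N) p.K (settingOfRecord₁₃ F N (theta13LiveOfRecord F N) p) ((theta13LiveOfRecord F N).Rz p.K) s.init t₀ (S, a) E₀).action23 k Uf =
        (sect2ActionDataOfRecord F N (FluctV N) p.K (settingOfRecord₁₃ F N (theta13LiveOfRecord F N) p) ((theta13LiveOfRecord F N).Rz p.K) s.init t₀ (S, a') E₀).action23 k Uf)
    {C : ℝ}
    (hmB : ∀ (t₀ : Sect2.TermValues (F.P p.K) (MatA N) (FluctV N) (theta13LiveOfRecord F N).τ9.M) (E₀ : ℝ),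
      ∀ S ∈ admSOfRecord F (theta13LiveOfRecord F N).ν (theta13LiveOfRecord F N).τ9.M (gOfRecord₁₃ F N (theta13LiveOfRecord F N) p) p.K k s.init,
      Measurable fun U₀ : GaugeField (F.P p.K) k (SU N) =>
        tkBranchOfRecord F N (FluctV N) (theta13LiveOfRecord F N).ν (theta13LiveOfRecord F N).τ9.M _ p.K
          (WtOfRecord₁₃H F N (rePinH (Stage13HParams.ofHistoryBlind F N (Stage13RParams.ofCured F N (theta13LiveOfRecord F N)))) p s) s.init S k
          (fun ω => sect2Operand F N (FluctV N) p.K (settingOfRecord₁₃ F N (theta13LiveOfRecord F N) p) ((theta13LiveOfRecord F N).Rz p.K) s.init t₀ E₀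
            (UbgOfRecord₁₃CoP F N (theta13LiveOfRecord F N) p k s.init) (S, fun j => (ω j).2) (fun j => (ω j).1))
          (baseCfg (V := FluctV N) k U₀))
    (hCB : ∀ (t₀ : Sect2.TermValues (F.P p.K) (MatA N) (FluctV N) (theta13LiveOfRecord F N).τ9.M) (E₀ : ℝ),
      ∀ S ∈ admSOfRecord F (theta13LiveOfRecord F N).ν (theta13LiveOfRecord F N).τ9.M (gOfRecord₁₃ F N (theta13LiveOfRecord F N) p) p.K k s.init,
      ∀ U₀ : GaugeField (F.P p.K) k (SU N),
      |tkBranchOfRecord F N (FluctV N) (theta13LiveOfRecord F N).ν (theta13LiveOfRecord F N).τ9.M _ p.K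
          (WtOfRecord₁₃H F N (rePinH (Stage13HParams.ofHistoryBlind F N (Stage13RParams.ofCured F N (theta13LiveOfRecord F N)))) p s) s.init S k
          (fun ω => sect2Operand F N (FluctV N) p.K (settingOfRecord₁₃ F N (theta13LiveOfRecord F N) p) ((theta13LiveOfRecord F N).Rz p.K) s.init t₀ E₀
            (UbgOfRecord₁₃CoP F N (theta13LiveOfRecord F N) p k s.init) (S, fun j => (ω j).2) (fun j => (ω j).1))
          (baseCfg (V := FluctV N) k U₀)| ≤ C) :
    ∃ (t₀ : Sect2.TermValues (F.P p.K) (MatA N) (FluctV N) (theta13LiveOfRecord F N).τ9.M) (E' : ℝ),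
      slotsOfRecord F N (theta13LiveOfRecord F N).ν (theta13LiveOfRecord F N).τ9 (EOfRecord₁₃ F N (theta13LiveOfRecord F N))
          (wOfRecord₉ F N (theta13LiveOfRecord F N).toStage9Params) (theta13LiveOfRecord F N).ppSel p (gOfRecord₁₃ F N (theta13LiveOfRecord F N) p) (k + 1) s = 0 ∨
        ∀ᵐ V' ∂fieldMeasure (F.P p.K) (k + 1) (SU N),
          chiSeqOfRecord F N (theta13LiveOfRecord F N).ν (theta13LiveOfRecord F N).τ9.M (gOfRecord₁₃ F N (theta13LiveOfRecord F N) p) p.K (k + 1) s V' ≠ 0 →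
            slotsOfRecord F N (theta13LiveOfRecord F N).ν (theta13LiveOfRecord F N).τ9 (EOfRecord₁₃ F N (theta13LiveOfRecord F N))
                (wOfRecord₉ F N (theta13LiveOfRecord F N).toStage9Params) (theta13LiveOfRecord F N).ppSel p (gOfRecord₁₃ F N (theta13LiveOfRecord F N) p) (k + 1) s V' =
              sect2Slot F N (FluctV N) p.K (settingOfRecord₁₃ F N (theta13LiveOfRecord F N) p) ((theta13LiveOfRecord F N).Rz p.K)
                (WtOfRecord₁₃H F N (rePinH (Stage13HParams.ofHistoryBlind F N (Stage13RParams.ofCured F N (theta13LiveOfRecord F N)))) p s) s t₀ E'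
                (UbgOfRecord₁₃CoP F N (theta13LiveOfRecord F N) p (k + 1) s) V' := by
  obtain ⟨t₀, E', hT⟩ := exists_clause_succ_rePinH_door_ofCured_of_Omega_empty (theta13LiveOfRecord F N) p h hk (le_of_eq rfl) hS s hΩ hA hmB hCB
  exact ⟨t₀, E', slotClauseΦ_succ_of_slotTClauseΦ_theta13LiveOfRecord F N p k hk s _ fun _ => hT⟩

end DoorRecord

end Summit.QuantumFields.YangMills.Theorems.BalabanUVNodesN11NoExpansionGeneralStepRePinnedPostRCoPH

end
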